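import Literature.NumberTheory.Sieve.FriedlanderIwaniecPrimesDirichletBilinear
import Mathlib.Analysis.SpecialFunctions.Pow.Real
import Mathlib.Analysis.MeanInequalitiesPow
import Mathlib.Algebra.Order.Chebyshev
import HarnessLib

/-!
# Friedlander–Iwaniec, *The polynomial `X² + Y⁴` captures its primes*, §21: Proposition 21.3 for `Q*(M, N)`

Family `parity`, statement parity.S17. Source: J. Friedlander, H. Iwaniec, Ann. of Math. (2) 148 (1998),
945–1040 [FriedlanderIwaniecAnnals1998], §21 (21.8)–(21.10): from Lemma 21.2, "exploiting the
multiplicativity of `ξ_w(z)` in `z`. Applying Hölder's inequality we get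
`Q^k(M, N) ≪ M^{k-1} Σ*_w |Σ_z β_z (z/w)|^k = M^{k-1} Q̃(M, N^k)` … with `k = 6`, getting (21.9)
`Q(M, N) ≪ {M^{4/3} N^{1/2} + M^{7/6} N^{3/4} + M^{11/12} N}(MN)^ε` … Now we refine (21.9) by exploiting the
reciprocity law (19.12). This requires both `w` and `z` to be primary primitive. Let `Q*(M, N)` denote the
form (21.1) restricted to primary primitive `w` and `z`. Of course, (21.9) holds for `Q*(M, N)`.
Interchanging `w` with `z` … we deduce that `Q*(M, N) ≪ (MN^{11/12} + NM^{11/12})(MN)^ε`."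

Everything here is PROVED:

* `norm_dirichletBilin_box_le_rpow` — **(21.9) in box form**: for `W` a finite set of primary
  primitive `w` with `2 ≤ |w|² ≤ M`, `|α|, |β| ≤ 1`, and `Z` the box `|Re z|, |Im z| ≤ X`, `Y = X + 1`:
  `‖Q‖ ≤ C_ε (Y M)^ε (Y² M^{11/12} + Y^{3/2} M^{7/6})` (the Hölder step with `k = 6`; `Y² ≍ N`);
* `norm_dirichletBilinStar_le` — **Proposition 21.3 for `Q*`** as displayed in the source:
  `‖Q*(M, N)‖ ≤ C_ε (M + N)^{1/12} (MN)^{11/12 + ε}` for all `M, N ≥ 1` and all `|α|, |β| ≤ 1`, where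
  `Q* = Σ_{w pp, |w|² ≤ M} Σ_{z pp, |z|² ≤ N} α_w β_z (z/w)` (`pp` = primary and primitive).

The extension from `Q*` to arbitrary `z` ((21.10) for `Q`, via `z = d z₀`) is not in this file; the
sequel of the source (Proposition 21.4, §23) uses the bound through the Jacobi–Kubota symbol `[wz]`,
which vanishes unless `wz` is primitive.

## Proof sketch (as in the source, made effective)

With `S_w = Σ_{z ≠ 0} β_z ξ_w(z)` (the term `z = 0` vanishes as `|w|² > 1`) and `c_w = S̄_w⁶/|S_w⁶|`:
`(Σ_w |S_w|)⁶ ≤ |W|⁵ Σ_w |S_w|⁶ = |W|⁵ Σ_w c_w S_w⁶ = |W|⁵ Q(c, β̃; W, box X')`, `X' = 8X⁶`, where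
`β̃_{z'} = Σ_{z₁⋯z₆ = z'} β_{z₁}⋯β_{z₆}` by complete multiplicativity (`dirichletSym_prod`);
`‖β̃‖₂² ≤ max_{z'} #{z₁⋯z₆ = z'} · |Z|⁶ ≤ 4⁶ τ(|z'|²)¹² |Z|⁶ ≪ Y^{ε} Y^{12}` (`card_filter_dvd_le`, divisor
bound); and Lemma 21.2 in box form (`norm_sq_dirichletBilin_box_le`, `card_sqNormPairs_le_rpow`) bounds
`Q(c, β̃)`. For `Q*`: the set of primary primitive `z` with `|z|² ≤ N` lies in the box `X = ⌊√N⌋`, the bound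
is symmetric under `(w, M, α) ↔ (z, N, β)` by (19.12) (`dirichletSym_comm`), and
`min{N M^{11/12} + N^{3/4} M^{7/6}, M N^{11/12} + M^{3/4} N^{7/6}} ≤ 2 (M+N)^{1/12} (MN)^{11/12}`.

## References

* J. Friedlander, H. Iwaniec, Ann. of Math. (2) 148 (1998), 945–1040, §21, (21.8)–(21.10), Proposition 21.3.
  [FriedlanderIwaniecAnnals1998]
-/

noncomputable section

open Finset
open Fintype (piFinset mem_piFinset card_piFinset)
open scoped ComplexConjugate

namespace Literature.NumberTheory.Sieve.FriedlanderIwaniecPrimes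

open Literature.NumberTheory.QuadraticFields.GaussianPrimary
open Literature.NumberTheory.LFunctions.GaussianTheta (normEq mem_normEq)
open Literature.NumberTheory.LFunctions.GaussianInt (IsPrimitive)

/-! ### Step A: Lemma 21.2 in box form with the square-pair count inserted -/

/-- Lemma 21.2, box form, with `SQ(W) ≪ M^{1+ε}` inserted: `‖Q‖² ≤ ‖β‖₂² ((2X+1)² C M^{1+ε} + 2M²(2X+1)|W|²)`.
[cite: FriedlanderIwaniecAnnals1998, Lemma 21.2] -/
theorem norm_sq_dirichletBilin_box_le_rpow {ε : ℝ} (hε : 0 < ε) :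
    ∃ C : ℝ, 0 < C ∧ ∀ (M X : ℕ) (W : Finset GaussianInt),
      (∀ w ∈ W, (IsPrimary w ∧ IsPrimitive w) ∧ w.norm.natAbs ≤ M) → ∀ (α β : GaussianInt → ℂ),
      (∀ w, ‖α w‖ ≤ 1) →
        ‖dirichletBilin α β W (gaussBox X)‖ ^ 2 ≤
          (∑ z ∈ gaussBox X, ‖β z‖ ^ 2) *
            ((2 * X + 1) ^ 2 * (C * (M : ℝ) ^ (1 + ε)) + 2 * M ^ 2 * (2 * X + 1) * #W ^ 2) := by
  obtain ⟨C, hC, hSQ⟩ := card_sqNormPairs_le_rpow hε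
  refine ⟨C, hC, fun M X W hW α β hα => ?_⟩
  refine (norm_sq_dirichletBilin_box_le W hW α β hα X).trans ?_
  refine mul_le_mul_of_nonneg_left ?_ (sum_nonneg fun z _ => by positivity)
  have := hSQ M W fun w hw => ⟨natAbs_norm_ne_zero_of_isPrimary (hW w hw).1.1, (hW w hw).2⟩
  gcongr

/-! ### Step B: the Hölder step, `k = 6` -/

/-- The number of Gaussian integers in a finite set with norm at most `M` is at most `(2√M + 1)²`. [folklore] -/
theorem card_le_of_norm_le {M : ℕ} (W : Finset GaussianInt) (hW : ∀ w ∈ W, w.norm.natAbs ≤ M) :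
    #W ≤ (2 * Nat.sqrt M + 1) ^ 2 := by
  rw [← card_gaussBox]
  refine card_le_card fun w hw => mem_gaussBox.mpr ?_
  have h := hW w hw
  have e : w.norm = w.re ^ 2 + w.im ^ 2 := by rw [Zsqrtd.norm_def]; ring
  have hn : w.re ^ 2 + w.im ^ 2 ≤ (M : ℤ) := by
    rw [← e, ← GaussianInt.abs_natCast_norm]; exact_mod_cast h
  have hre : w.re.natAbs ≤ Nat.sqrt M := by
    rw [Nat.le_sqrt']
    have : (w.re.natAbs : ℤ) ^ 2 ≤ M := by rw [Int.natAbs_sq]; nlinarith [sq_nonneg w.im]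
    exact_mod_cast this
  have him : w.im.natAbs ≤ Nat.sqrt M := by
    rw [Nat.le_sqrt']
    have : (w.im.natAbs : ℤ) ^ 2 ≤ M := by rw [Int.natAbs_sq]; nlinarith [sq_nonneg w.re]
    exact_mod_cast this
  rw [Int.abs_eq_natAbs, Int.abs_eq_natAbs]
  exact ⟨by exact_mod_cast hre, by exact_mod_cast him⟩

/-- `(2√M + 1)² ≤ 9M` for `M ≥ 1`. [folklore] -/
theorem sq_two_sqrt_add_one_le {M : ℕ} (hM : 1 ≤ M) : ((2 * Nat.sqrt M + 1) ^ 2 : ℝ) ≤ 9 * M := by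
  have h1 : (Nat.sqrt M : ℝ) ^ 2 ≤ M := by exact_mod_cast Nat.sqrt_le' M
  have h2 : (1 : ℝ) ≤ Nat.sqrt M := by exact_mod_cast Nat.le_sqrt.mpr (by simpa using hM)
  nlinarith

/-- For `|w|² ≥ 2`, `ξ_w(0) = 0`. [folklore] -/
theorem dirichletSym_zero_of_two_le {w : GaussianInt} (hw : 2 ≤ w.norm.natAbs) : dirichletSym 0 w = 0 := by
  rw [dirichletSym_def, mul_zero, Zsqrtd.re_zero]
  exact jacobiSym.zero_left hw

/-- Coordinates of a product of six box elements: if `|Re zᵢ|, |Im zᵢ| ≤ X` then the product lies in the box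
`8X⁶`. [folklore] -/
theorem prod_mem_gaussBox {X : ℕ} (x : Fin 6 → GaussianInt) (hx : ∀ i, x i ∈ gaussBox X) :
    (∏ i, x i) ∈ gaussBox (8 * X ^ 6) := by
  -- norms: `N(∏ xᵢ) = ∏ N(xᵢ) ≤ (2X²)⁶ = (8X⁶)²`
  have hN : ∀ i, (x i).norm ≤ 2 * (X : ℤ) ^ 2 := by
    intro i
    obtain ⟨h1, h2⟩ := mem_gaussBox.mp (hx i)
    obtain ⟨h1a, h1b⟩ := abs_le.mp h1
    obtain ⟨h2a, h2b⟩ := abs_le.mp h2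
    rw [show (x i).norm = (x i).re ^ 2 + (x i).im ^ 2 by rw [Zsqrtd.norm_def]; ring]
    nlinarith [mul_nonneg (sub_nonneg.mpr h1b) (neg_le_iff_add_nonneg'.mp h1a),
      mul_nonneg (sub_nonneg.mpr h2b) (neg_le_iff_add_nonneg'.mp h2a)]
  have hprod : (∏ i, x i).norm ≤ (8 * (X : ℤ) ^ 6) ^ 2 := by
    rw [show (∏ i, x i).norm = ∏ i, (x i).norm from map_prod Zsqrtd.normMonoidHom _ _]
    calc ∏ i, (x i).norm ≤ ∏ _i : Fin 6, (2 * (X : ℤ) ^ 2) :=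
          prod_le_prod (fun i _ => GaussianInt.norm_nonneg _) fun i _ => hN i
      _ = (8 * (X : ℤ) ^ 6) ^ 2 := by rw [prod_const, card_univ, Fintype.card_fin]; ring
  set P := ∏ i, x i
  have e : P.norm = P.re ^ 2 + P.im ^ 2 := by rw [Zsqrtd.norm_def]; ring
  rw [mem_gaussBox]
  have h8 : (0 : ℤ) ≤ 8 * (X : ℤ) ^ 6 := by positivity
  have hre : P.re ^ 2 ≤ (8 * (X : ℤ) ^ 6) ^ 2 := by nlinarith [sq_nonneg P.im]
  have him : P.im ^ 2 ≤ (8 * (X : ℤ) ^ 6) ^ 2 := by nlinarith [sq_nonneg P.re]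
  have hre' := sq_le_sq.mp hre
  have him' := sq_le_sq.mp him
  rw [abs_of_nonneg h8] at hre' him'
  push_cast
  exact ⟨hre', him'⟩

/-! ### Step B continued: the sixth-power identity -/

/-- The nonzero points of the box. [folklore] -/
def gaussBox₀ (X : ℕ) : Finset GaussianInt := (gaussBox X).filter (· ≠ 0)

/-- `S_w = Σ_{z ∈ box, z ≠ 0} β_z ξ_w(z)`. [cite: FriedlanderIwaniecAnnals1998, Lemma 21.2 (proof)] -/
def charSum (β : GaussianInt → ℂ) (X : ℕ) (w : GaussianInt) : ℂ :=
  ∑ z ∈ gaussBox₀ X, β z * (dirichletSym z w : ℂ)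

/-- Six-sixTuples of nonzero box points. [folklore] -/
def sixTuples (X : ℕ) : Finset (Fin 6 → GaussianInt) := piFinset fun _ => gaussBox₀ X

/-- The prodFibre of the product map over `z'`. [folklore] -/
def prodFibre (X : ℕ) (z' : GaussianInt) : Finset (Fin 6 → GaussianInt) :=
  (sixTuples X).filter fun x => ∏ i, x i = z'

/-- `β̃_{z'} = Σ_{z₁⋯z₆ = z'} β_{z₁}⋯β_{z₆}` ("`β̃_z = Σ_{z₁…z_k = z} β_{z₁}…β_{z_k}`", `k = 6`).
[cite: FriedlanderIwaniecAnnals1998, §21 before (21.9)] -/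
def betaTilde (β : GaussianInt → ℂ) (X : ℕ) (z' : GaussianInt) : ℂ := ∑ x ∈ prodFibre X z', ∏ i, β (x i)

/-- The unimodular phase `ū/|u|` (`0` at `u = 0`). [folklore] -/
def phase (u : ℂ) : ℂ := if u = 0 then 0 else conj u / (‖u‖ : ℂ)

/-- `phase u · u = |u|`. [folklore] -/
theorem phase_mul_self (u : ℂ) : phase u * u = (‖u‖ : ℂ) := by
  unfold phase
  split_ifs with h
  · simp [h]
  · have hn : (‖u‖ : ℂ) ≠ 0 := by exact_mod_cast (norm_ne_zero_iff.mpr h)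
    rw [div_mul_eq_mul_div, div_eq_iff hn, mul_comm (conj u), Complex.mul_conj, Complex.normSq_eq_norm_sq]
    push_cast; ring

/-- `|phase u| ≤ 1`. [folklore] -/
theorem norm_phase_le (u : ℂ) : ‖phase u‖ ≤ 1 := by
  unfold phase
  split_ifs with h
  · simp
  · rw [norm_div, Complex.norm_conj, Complex.norm_real, Real.norm_eq_abs, abs_of_nonneg (norm_nonneg _),
      div_self (norm_ne_zero_iff.mpr h)]

/-- Points of `gaussBox₀`. [folklore] -/
theorem mem_gaussBox₀ {X : ℕ} {z : GaussianInt} : z ∈ gaussBox₀ X ↔ z ∈ gaussBox X ∧ z ≠ 0 := mem_filter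

/-- Tuples have entries in the box. [folklore] -/
theorem mem_sixTuples {X : ℕ} {x : Fin 6 → GaussianInt} : x ∈ sixTuples X ↔ ∀ i, x i ∈ gaussBox₀ X := mem_piFinset

/-- The product of a tuple lies in the box `8X⁶`. [folklore] -/
theorem prod_mem_of_mem_sixTuples {X : ℕ} {x : Fin 6 → GaussianInt} (hx : x ∈ sixTuples X) :
    (∏ i, x i) ∈ gaussBox (8 * X ^ 6) :=
  prod_mem_gaussBox x fun i => (mem_gaussBox₀.mp (mem_sixTuples.mp hx i)).1

/-- **Complete multiplicativity expands the sixth power**: `S_w⁶ = Σ_x β_{x₁}⋯β_{x₆} ξ_w(x₁⋯x₆)`.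
[cite: FriedlanderIwaniecAnnals1998, §21 before (21.9)] -/
theorem charSum_pow_six {w : GaussianInt} (hw : IsPrimary w ∧ IsPrimitive w) (β : GaussianInt → ℂ) (X : ℕ) :
    charSum β X w ^ 6 = ∑ x ∈ sixTuples X, (∏ i, β (x i)) * (dirichletSym (∏ i, x i) w : ℂ) := by
  rw [charSum, sum_pow']
  refine sum_congr rfl fun x _ => ?_
  rw [prod_mul_distrib, dirichletSym_prod hw.1 hw.2, Int.cast_prod]

/-- Regrouping by the value of the product: `Σ_x B_x ξ_w(P x) = Σ_{z'} β̃_{z'} ξ_w(z')`. [folklore] -/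
theorem sum_tuples_eq_sum_betaTilde (w : GaussianInt) (β : GaussianInt → ℂ) (X : ℕ) :
    ∑ x ∈ sixTuples X, (∏ i, β (x i)) * (dirichletSym (∏ i, x i) w : ℂ) =
      ∑ z' ∈ gaussBox (8 * X ^ 6), betaTilde β X z' * (dirichletSym z' w : ℂ) := by
  rw [← sum_fiberwise_of_maps_to (s := sixTuples X) (t := gaussBox (8 * X ^ 6)) (g := fun x => ∏ i, x i)
    (fun x hx => prod_mem_of_mem_sixTuples hx)]
  refine sum_congr rfl fun z' _ => ?_
  rw [betaTilde, prodFibre, sum_mul]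
  refine sum_congr rfl fun x hx => ?_
  rw [(mem_filter.mp hx).2]

/-- **The Hölder form as a bilinear form**: with `c_w = phase(S_w⁶)`,
`Q(c, β̃; W, box 8X⁶) = Σ_w c_w S_w⁶ = Σ_w |S_w|⁶`. [cite: FriedlanderIwaniecAnnals1998, §21 before (21.9)] -/
theorem dirichletBilin_phase_betaTilde {W : Finset GaussianInt} (hW : ∀ w ∈ W, IsPrimary w ∧ IsPrimitive w)
    (β : GaussianInt → ℂ) (X : ℕ) :
    dirichletBilin (fun w => phase (charSum β X w ^ 6)) (betaTilde β X) W (gaussBox (8 * X ^ 6)) =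
      ((∑ w ∈ W, ‖charSum β X w‖ ^ 6 : ℝ) : ℂ) := by
  rw [dirichletBilin_def, Complex.ofReal_sum]
  refine sum_congr rfl fun w hw => ?_
  have e : ∑ z ∈ gaussBox (8 * X ^ 6), phase (charSum β X w ^ 6) * betaTilde β X z * (dirichletSym z w : ℂ) =
      phase (charSum β X w ^ 6) * charSum β X w ^ 6 := by
    rw [charSum_pow_six (hW w hw), sum_tuples_eq_sum_betaTilde, mul_sum]
    exact sum_congr rfl fun z _ => by ring
  rw [e, phase_mul_self, norm_pow, Complex.ofReal_pow]

/-- `Σ_w |S_w|⁶ = ‖Q(c, β̃)‖`. [cite: FriedlanderIwaniecAnnals1998, §21 before (21.9)] -/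
theorem sum_norm_charSum_pow_six_eq {W : Finset GaussianInt} (hW : ∀ w ∈ W, IsPrimary w ∧ IsPrimitive w)
    (β : GaussianInt → ℂ) (X : ℕ) :
    ∑ w ∈ W, ‖charSum β X w‖ ^ 6 =
      ‖dirichletBilin (fun w => phase (charSum β X w ^ 6)) (betaTilde β X) W (gaussBox (8 * X ^ 6))‖ := by
  rw [dirichletBilin_phase_betaTilde hW, Complex.norm_of_nonneg (sum_nonneg fun w _ => by positivity)]

/-! ### Step B continued: the size of `β̃` -/

/-- The prodFibre over `z'` consists of sixTuples of divisors of `z'`, hence has at most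
`#{z ∈ box₀ : z ∣ z'}⁶` elements; it is empty over `z' = 0`. [folklore] -/
theorem card_prodFibre_le {X : ℕ} (z' : GaussianInt) [DecidablePred (· ∣ z')] :
    #(prodFibre X z') ≤ #((gaussBox₀ X).filter (· ∣ z')) ^ 6 := by
  have hsub : prodFibre X z' ⊆ piFinset fun _ : Fin 6 => (gaussBox₀ X).filter (· ∣ z') := by
    intro x hx
    rw [prodFibre, mem_filter] at hx
    obtain ⟨hx, hP⟩ := hx
    rw [mem_piFinset]
    intro i
    rw [mem_filter]
    refine ⟨mem_sixTuples.mp hx i, ?_⟩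
    rw [← hP]
    exact dvd_prod_of_mem _ (mem_univ i)
  refine (card_le_card hsub).trans ?_
  rw [card_piFinset, prod_const, card_univ, Fintype.card_fin]

/-- The prodFibre over `0` is empty (products of nonzero Gaussian integers are nonzero). [folklore] -/
theorem prodFibre_zero (X : ℕ) : prodFibre X 0 = ∅ := by
  rw [prodFibre, filter_eq_empty_iff]
  intro x hx
  exact prod_ne_zero_iff.mpr fun i _ => (mem_gaussBox₀.mp (mem_sixTuples.mp hx i)).2

/-- `‖β̃_{z'}‖ ≤ Σ_{prodFibre} ‖B_x‖ ≤ #prodFibre(z')` for `|β| ≤ 1`. [folklore] -/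
theorem norm_betaTilde_le {β : GaussianInt → ℂ} (hβ : ∀ z, ‖β z‖ ≤ 1) (X : ℕ) (z' : GaussianInt) :
    ‖betaTilde β X z'‖ ≤ ∑ x ∈ prodFibre X z', ‖∏ i, β (x i)‖ ∧ ∑ x ∈ prodFibre X z', ‖∏ i, β (x i)‖ ≤ #(prodFibre X z') := by
  constructor
  · exact norm_sum_le _ _
  · have := sum_le_card_nsmul (prodFibre X z') (fun x => ‖∏ i, β (x i)‖) 1 fun x _ => by
      rw [norm_prod]
      exact prod_le_one (fun i _ => norm_nonneg _) fun i _ => hβ _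
    simpa using this

/-- **`‖β̃‖₂² ≤ D · #sixTuples`** whenever every prodFibre has at most `D` elements. [folklore] -/
theorem sum_norm_sq_betaTilde_le {β : GaussianInt → ℂ} (hβ : ∀ z, ‖β z‖ ≤ 1) (X : ℕ) {D : ℝ}
    (hD : ∀ z' ∈ gaussBox (8 * X ^ 6), (#(prodFibre X z') : ℝ) ≤ D) :
    ∑ z' ∈ gaussBox (8 * X ^ 6), ‖betaTilde β X z'‖ ^ 2 ≤ D * #(sixTuples X) := by
  have key : ∀ z' ∈ gaussBox (8 * X ^ 6), ‖betaTilde β X z'‖ ^ 2 ≤ D * ∑ x ∈ prodFibre X z', ‖∏ i, β (x i)‖ := by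
    intro z' hz'
    obtain ⟨h1, h2⟩ := norm_betaTilde_le hβ X z'
    have h0 : 0 ≤ ∑ x ∈ prodFibre X z', ‖∏ i, β (x i)‖ := sum_nonneg fun x _ => norm_nonneg _
    calc ‖betaTilde β X z'‖ ^ 2 ≤ (∑ x ∈ prodFibre X z', ‖∏ i, β (x i)‖) ^ 2 := by gcongr
      _ = (∑ x ∈ prodFibre X z', ‖∏ i, β (x i)‖) * (∑ x ∈ prodFibre X z', ‖∏ i, β (x i)‖) := sq _
      _ ≤ #(prodFibre X z') * (∑ x ∈ prodFibre X z', ‖∏ i, β (x i)‖) := by gcongr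
      _ ≤ D * ∑ x ∈ prodFibre X z', ‖∏ i, β (x i)‖ := by gcongr; exact hD z' hz'
  refine (sum_le_sum key).trans ?_
  rw [← mul_sum]
  refine mul_le_mul_of_nonneg_left ?_ ?_
  · have e : ∑ z' ∈ gaussBox (8 * X ^ 6), ∑ x ∈ prodFibre X z', ‖∏ i, β (x i)‖ = ∑ x ∈ sixTuples X, ‖∏ i, β (x i)‖ :=
      sum_fiberwise_of_maps_to (s := sixTuples X) (t := gaussBox (8 * X ^ 6)) (g := fun x => ∏ i, x i)
        (fun x hx => prod_mem_of_mem_sixTuples hx) _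
    rw [e]
    have := sum_le_card_nsmul (sixTuples X) (fun x => ‖∏ i, β (x i)‖) 1 fun x _ => by
      rw [norm_prod]; exact prod_le_one (fun i _ => norm_nonneg _) fun i _ => hβ _
    simpa using this
  · have h0 : (0 : GaussianInt) ∈ gaussBox (8 * X ^ 6) := mem_gaussBox_of_norm_le (by simp)
    exact le_trans (by positivity) (hD 0 h0)

/-- The number of sixTuples is at most `(2X+1)^{12}`. [folklore] -/
theorem card_sixTuples_le (X : ℕ) : #(sixTuples X) ≤ (2 * X + 1) ^ 12 := by
  rw [sixTuples, card_piFinset, prod_const, card_univ, Fintype.card_fin]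
  calc #(gaussBox₀ X) ^ 6 ≤ #(gaussBox X) ^ 6 := Nat.pow_le_pow_left (card_filter_le _ _) 6
    _ = (2 * X + 1) ^ 12 := by rw [card_gaussBox]; ring

/-- Norms in the box `8X⁶` are at most `128 (X+1)^{12}`. [folklore] -/
theorem natAbs_norm_le_of_mem_gaussBox {X : ℕ} {z : GaussianInt} (hz : z ∈ gaussBox (8 * X ^ 6)) :
    z.norm.natAbs ≤ 128 * (X + 1) ^ 12 := by
  obtain ⟨h1, h2⟩ := mem_gaussBox.mp hz
  obtain ⟨h1a, h1b⟩ := abs_le.mp h1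
  obtain ⟨h2a, h2b⟩ := abs_le.mp h2
  have e := natAbs_norm_eq_sq_add_sq z
  have hre : z.re ^ 2 ≤ ((8 * X ^ 6 : ℕ) : ℤ) ^ 2 := by
    nlinarith [mul_nonneg (sub_nonneg.mpr h1b) (neg_le_iff_add_nonneg'.mp h1a)]
  have him : z.im ^ 2 ≤ ((8 * X ^ 6 : ℕ) : ℤ) ^ 2 := by
    nlinarith [mul_nonneg (sub_nonneg.mpr h2b) (neg_le_iff_add_nonneg'.mp h2a)]
  have hX : ((8 * X ^ 6 : ℕ) : ℤ) ^ 2 ≤ 64 * ((X : ℤ) + 1) ^ 12 := by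
    have : (X : ℤ) ^ 6 ≤ ((X : ℤ) + 1) ^ 6 := by gcongr; linarith
    push_cast; nlinarith [this, pow_nonneg (by positivity : (0:ℤ) ≤ X) 6]
  have : (z.norm.natAbs : ℤ) ≤ 128 * ((X : ℤ) + 1) ^ 12 := by rw [e]; linarith
  exact_mod_cast this

/-! ### Step B concluded: (21.9) in box form -/

/-- `‖Q‖ ≤ Σ_w |S_w|` when `|α| ≤ 1` and every `|w|² ≥ 2` (the term `z = 0` drops out). [folklore] -/
theorem norm_dirichletBilin_le_sum_norm_charSum {W : Finset GaussianInt} (hW : ∀ w ∈ W, 2 ≤ w.norm.natAbs)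
    (α β : GaussianInt → ℂ) (hα : ∀ w, ‖α w‖ ≤ 1) (X : ℕ) :
    ‖dirichletBilin α β W (gaussBox X)‖ ≤ ∑ w ∈ W, ‖charSum β X w‖ := by
  rw [dirichletBilin_def]
  refine (norm_sum_le _ _).trans (sum_le_sum fun w hw => ?_)
  have e : ∑ z ∈ gaussBox X, α w * β z * (dirichletSym z w : ℂ) = α w * charSum β X w := by
    rw [charSum, mul_sum, gaussBox₀, sum_filter]
    refine sum_congr rfl fun z _ => ?_
    split_ifs with hz
    · ring
    · rw [not_ne_iff] at hz
      rw [hz, dirichletSym_zero_of_two_le (hW w hw)]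
      simp
  rw [e, norm_mul]
  calc ‖α w‖ * ‖charSum β X w‖ ≤ 1 * ‖charSum β X w‖ := by gcongr; exact hα w
    _ = _ := one_mul _

/-- Twelfth roots of the two model terms. [folklore] -/
theorem rpow_model_terms {Y M ε : ℝ} (hY : 0 ≤ Y) (hM : 0 ≤ M) :
    (Y ^ 24 * M ^ (11 + ε)) ^ (1 / 12 : ℝ) = Y ^ 2 * M ^ ((11 + ε) / 12) ∧
      (Y ^ 18 * M ^ 14) ^ (1 / 12 : ℝ) = Y ^ (3 / 2 : ℝ) * M ^ (7 / 6 : ℝ) := by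
  constructor
  · rw [Real.mul_rpow (by positivity) (by positivity), ← Real.rpow_natCast Y 24, ← Real.rpow_mul hY,
      ← Real.rpow_mul hM]
    norm_num
    left
    rw [show ((11 + ε) / 12 : ℝ) = (11 + ε) * (1 / 12) by ring]
  · rw [Real.mul_rpow (by positivity) (by positivity), ← Real.rpow_natCast Y 18, ← Real.rpow_mul hY,
      ← Real.rpow_natCast M 14, ← Real.rpow_mul hM]
    norm_num

/-- **FI (21.9), box form (the Hölder step with `k = 6`).** For every `ε > 0` there is `C` such that for all
`M, X`, every finite set `W` of primary primitive `w` with `2 ≤ |w|² ≤ M`, and all coefficients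
`|α|, |β| ≤ 1`, the form `Q = Σ_{w ∈ W} Σ_{|Re z|, |Im z| ≤ X} α_w β_z (z/w)` satisfies, with `Y = X + 1`,
`‖Q‖ ≤ C (Y M)^ε (Y² M^{11/12} + Y^{3/2} M^{7/6})`. (In the source `Y² ≍ N`: this is
`Q ≪ (M^{11/12} N + M^{7/6} N^{3/4})(MN)^ε`, i.e. (21.9) without its redundant first term.)
[cite: FriedlanderIwaniecAnnals1998, (21.9)] -/
theorem norm_dirichletBilin_box_le_rpow {ε : ℝ} (hε : 0 < ε) :
    ∃ C : ℝ, 0 < C ∧ ∀ (M X : ℕ) (W : Finset GaussianInt),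
      (∀ w ∈ W, (IsPrimary w ∧ IsPrimitive w) ∧ 2 ≤ w.norm.natAbs ∧ w.norm.natAbs ≤ M) →
      ∀ (α β : GaussianInt → ℂ), (∀ w, ‖α w‖ ≤ 1) → (∀ z, ‖β z‖ ≤ 1) →
        ‖dirichletBilin α β W (gaussBox X)‖ ≤
          C * (((X : ℝ) + 1) * M) ^ ε *
            (((X : ℝ) + 1) ^ 2 * (M : ℝ) ^ (11 / 12 : ℝ) + ((X : ℝ) + 1) ^ (3 / 2 : ℝ) * (M : ℝ) ^ (7 / 6 : ℝ)) := by
  obtain ⟨C₁, hC₁, hA⟩ := norm_sq_dirichletBilin_box_le_rpow hε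
  obtain ⟨C₂, hC₂, hτ⟩ :=
    Literature.NumberTheory.Sieve.exists_card_divisors_le_mul_rpow (ε := ε / 12) (by positivity)
  obtain ⟨P, hP⟩ : ∃ P : ℝ, P = 9 ^ 10 * 4 ^ 12 * C₂ ^ 12 * (128 : ℝ) ^ ε := ⟨_, rfl⟩
  have hPpos : 0 < P := by rw [hP]; positivity
  obtain ⟨K₀, hK₀⟩ : ∃ K : ℝ, K = P * (289 * C₁ + 2754) := ⟨_, rfl⟩
  have hK₀pos : 0 < K₀ := by rw [hK₀]; positivity
  have hKr : 0 < K₀ ^ (1 / 12 : ℝ) := Real.rpow_pos_of_pos hK₀pos _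
  refine ⟨K₀ ^ (1 / 12 : ℝ), hKr, fun M X W hW α β hα hβ => ?_⟩
  rcases W.eq_empty_or_nonempty with rfl | ⟨w₀, hw₀⟩
  · simp only [dirichletBilin_def, Finset.sum_empty, norm_zero]; positivity
  have hM : 1 ≤ M := le_trans (by norm_num) ((hW w₀ hw₀).2.1.trans (hW w₀ hw₀).2.2)
  have hMr : (1 : ℝ) ≤ M := by exact_mod_cast hM
  have hM0 : (0 : ℝ) < M := by linarith
  obtain ⟨Y, hY⟩ : ∃ Y : ℝ, Y = (X : ℝ) + 1 := ⟨_, rfl⟩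
  have hY1 : 1 ≤ Y := by rw [hY]; linarith [(Nat.cast_nonneg X : (0 : ℝ) ≤ X)]
  have hY0 : 0 < Y := by linarith
  obtain ⟨Ssum, hSsum⟩ : ∃ S : ℝ, S = ∑ w ∈ W, ‖charSum β X w‖ := ⟨_, rfl⟩
  have hSsum0 : 0 ≤ Ssum := by rw [hSsum]; exact sum_nonneg fun w _ => norm_nonneg _
  -- (1) `‖Q‖ ≤ Ssum`
  have h1 : ‖dirichletBilin α β W (gaussBox X)‖ ≤ Ssum := by
    rw [hSsum]; exact norm_dirichletBilin_le_sum_norm_charSum (fun w hw => (hW w hw).2.1) α β hα X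
  -- (2) Jensen / Hölder
  have h2 : Ssum ^ 6 ≤ (#W : ℝ) ^ 5 * ∑ w ∈ W, ‖charSum β X w‖ ^ 6 := by
    rw [hSsum]; exact pow_sum_le_card_mul_sum_pow (fun w _ => norm_nonneg _) 5
  -- (3) `Σ S⁶ = ‖Q̃‖`
  have hW' : ∀ w ∈ W, IsPrimary w ∧ IsPrimitive w := fun w hw => (hW w hw).1
  obtain ⟨Qt, hQt⟩ : ∃ Q : ℂ,
      Q = dirichletBilin (fun w => phase (charSum β X w ^ 6)) (betaTilde β X) W (gaussBox (8 * X ^ 6)) :=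
    ⟨_, rfl⟩
  have h3 : ∑ w ∈ W, ‖charSum β X w‖ ^ 6 = ‖Qt‖ := by rw [hQt]; exact sum_norm_charSum_pow_six_eq hW' β X
  -- (4) Lemma 21.2 (box form) for `Q̃`
  have h4 := hA M (8 * X ^ 6) W (fun w hw => ⟨(hW w hw).1, (hW w hw).2.2⟩)
    (fun w => phase (charSum β X w ^ 6)) (betaTilde β X) (fun w => norm_phase_le _)
  rw [← hQt] at h4
  -- (5) the fibres and `‖β̃‖₂²`
  obtain ⟨D, hD⟩ : ∃ D : ℝ, D = 4 ^ 6 * (C₂ * ((128 : ℝ) * Y ^ 12) ^ (ε / 12)) ^ 12 := ⟨_, rfl⟩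
  have hD0 : 0 ≤ D := by rw [hD]; positivity
  have hDfib : ∀ z' ∈ gaussBox (8 * X ^ 6), (#(prodFibre X z') : ℝ) ≤ D := by
    intro z' hz'
    by_cases hz0 : z' = 0
    · rw [hz0, prodFibre_zero, Finset.card_empty, Nat.cast_zero]; exact hD0
    · classical
      have hc := card_prodFibre_le (X := X) z'
      have hd := card_filter_dvd_le hz0 (gaussBox₀ X)
      have hn0 : z'.norm.natAbs ≠ 0 := by rwa [Ne, Int.natAbs_eq_zero, GaussianInt.norm_eq_zero]
      have hnle : (z'.norm.natAbs : ℝ) ≤ 128 * Y ^ 12 := by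
        have := natAbs_norm_le_of_mem_gaussBox hz'
        calc (z'.norm.natAbs : ℝ) ≤ ((128 * (X + 1) ^ 12 : ℕ) : ℝ) := by exact_mod_cast this
          _ = 128 * Y ^ 12 := by push_cast; rw [hY]
      have hτ' : (#(z'.norm.natAbs.divisors) : ℝ) ≤ C₂ * (128 * Y ^ 12) ^ (ε / 12) :=
        (hτ _ hn0).trans (by gcongr)
      calc (#(prodFibre X z') : ℝ) ≤ ((#((gaussBox₀ X).filter (· ∣ z')) ^ 6 : ℕ) : ℝ) := by exact_mod_cast hc
        _ ≤ (((4 * #(z'.norm.natAbs.divisors) ^ 2) ^ 6 : ℕ) : ℝ) := by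
            exact_mod_cast Nat.pow_le_pow_left hd 6
        _ = 4 ^ 6 * (#(z'.norm.natAbs.divisors) : ℝ) ^ 12 := by push_cast; ring
        _ ≤ 4 ^ 6 * (C₂ * (128 * Y ^ 12) ^ (ε / 12)) ^ 12 := by gcongr
        _ = D := hD.symm
  have h5 : ∑ z' ∈ gaussBox (8 * X ^ 6), ‖betaTilde β X z'‖ ^ 2 ≤ D * (2 * Y) ^ 12 := by
    refine (sum_norm_sq_betaTilde_le hβ X hDfib).trans ?_
    have : (#(sixTuples X) : ℝ) ≤ (2 * Y) ^ 12 := by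
      calc (#(sixTuples X) : ℝ) ≤ (((2 * X + 1) ^ 12 : ℕ) : ℝ) := by exact_mod_cast card_sixTuples_le X
        _ ≤ (2 * Y) ^ 12 := by push_cast; rw [hY]; gcongr; linarith
    gcongr
  -- (6) elementary sizes
  have hWc : (#W : ℝ) ≤ 9 * M := by
    have := card_le_of_norm_le W fun w hw => (hW w hw).2.2
    calc (#W : ℝ) ≤ (((2 * Nat.sqrt M + 1) ^ 2 : ℕ) : ℝ) := by exact_mod_cast this
      _ ≤ 9 * M := by push_cast; exact sq_two_sqrt_add_one_le hM
  have hX' : 2 * ((8 * X ^ 6 : ℕ) : ℝ) + 1 ≤ 17 * Y ^ 6 := by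
    have h6 : (X : ℝ) ^ 6 ≤ Y ^ 6 := by rw [hY]; gcongr; linarith
    have h6' : (1 : ℝ) ≤ Y ^ 6 := one_le_pow₀ hY1
    push_cast; linarith
  have hX'0 : (0 : ℝ) ≤ 2 * ((8 * X ^ 6 : ℕ) : ℝ) + 1 := by positivity
  have hR : (2 * ((8 * X ^ 6 : ℕ) : ℝ) + 1) ^ 2 * (C₁ * (M : ℝ) ^ (1 + ε)) +
      2 * (M : ℝ) ^ 2 * (2 * ((8 * X ^ 6 : ℕ) : ℝ) + 1) * (#W : ℝ) ^ 2 ≤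
      289 * C₁ * Y ^ 12 * (M : ℝ) ^ (1 + ε) + 2754 * Y ^ 6 * (M : ℝ) ^ 4 := by
    have hsq : (2 * ((8 * X ^ 6 : ℕ) : ℝ) + 1) ^ 2 ≤ 289 * Y ^ 12 := by nlinarith
    have hrp : (0 : ℝ) ≤ (M : ℝ) ^ (1 + ε) := by positivity
    have hW2 : (#W : ℝ) ^ 2 ≤ 81 * (M : ℝ) ^ 2 := by nlinarith [hWc, (Nat.cast_nonneg _ : (0:ℝ) ≤ #W)]
    calc _ ≤ 289 * Y ^ 12 * (C₁ * (M : ℝ) ^ (1 + ε)) + 2 * (M : ℝ) ^ 2 * (17 * Y ^ 6) * (81 * (M : ℝ) ^ 2) := by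
          gcongr
      _ = _ := by ring
  -- (7) `‖Q̃‖² ≤ D (2Y)^12 R'`
  have h7 : ‖Qt‖ ^ 2 ≤ D * (2 * Y) ^ 12 * (289 * C₁ * Y ^ 12 * (M : ℝ) ^ (1 + ε) + 2754 * Y ^ 6 * (M : ℝ) ^ 4) := by
    refine h4.trans ?_
    exact mul_le_mul h5 hR (by positivity) (by positivity)
  -- (8) `Ssum^12 ≤ K₀ Y^{12ε} (T₁ + T₂)`
  have hDexp : D = 4 ^ 6 * C₂ ^ 12 * ((128 : ℝ) ^ ε * Y ^ (12 * ε)) := by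
    have e1 : (((128 : ℝ) * Y ^ 12) ^ (ε / 12)) ^ 12 = ((128 : ℝ) * Y ^ 12) ^ ε := by
      rw [← Real.rpow_natCast (((128 : ℝ) * Y ^ 12) ^ (ε / 12)) 12, ← Real.rpow_mul (by positivity)]
      congr 1; push_cast; ring
    have e2 : ((128 : ℝ) * Y ^ 12) ^ ε = (128 : ℝ) ^ ε * Y ^ (12 * ε) := by
      rw [Real.mul_rpow (by norm_num) (by positivity), ← Real.rpow_natCast Y 12, ← Real.rpow_mul hY0.le]
      push_cast; rfl
    rw [hD, mul_pow, e1, e2]; ring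
  have hM10 : (M : ℝ) ^ 10 * (M : ℝ) ^ (1 + ε) = (M : ℝ) ^ (11 + ε) := by
    rw [← Real.rpow_natCast (M : ℝ) 10, ← Real.rpow_add hM0]
    congr 1; push_cast; ring
  obtain ⟨T₁, hT₁⟩ : ∃ T₁ : ℝ, T₁ = Y ^ 24 * (M : ℝ) ^ (11 + ε) := ⟨_, rfl⟩
  obtain ⟨T₂, hT₂⟩ : ∃ T₂ : ℝ, T₂ = Y ^ 18 * (M : ℝ) ^ 14 := ⟨_, rfl⟩
  have hT₁0 : 0 ≤ T₁ := by rw [hT₁]; positivity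
  have hT₂0 : 0 ≤ T₂ := by rw [hT₂]; positivity
  have h8a : Ssum ^ 12 ≤ (9 * (M : ℝ)) ^ 10 * ‖Qt‖ ^ 2 := by
    have hWQ : Ssum ^ 6 ≤ (9 * (M : ℝ)) ^ 5 * ‖Qt‖ := by
      refine h2.trans ?_
      rw [h3]
      exact mul_le_mul_of_nonneg_right (pow_le_pow_left₀ (Nat.cast_nonneg _) hWc 5) (norm_nonneg _)
    have h6 : 0 ≤ Ssum ^ 6 := by positivity
    calc Ssum ^ 12 = (Ssum ^ 6) ^ 2 := by ring
      _ ≤ ((9 * (M : ℝ)) ^ 5 * ‖Qt‖) ^ 2 := pow_le_pow_left₀ h6 hWQ 2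
      _ = (9 * (M : ℝ)) ^ 10 * ‖Qt‖ ^ 2 := by ring
  have h8b : (9 * (M : ℝ)) ^ 10 * ‖Qt‖ ^ 2 ≤
      (9 * (M : ℝ)) ^ 10 * (D * (2 * Y) ^ 12 * (289 * C₁ * Y ^ 12 * (M : ℝ) ^ (1 + ε) + 2754 * Y ^ 6 * (M : ℝ) ^ 4)) :=
    mul_le_mul_of_nonneg_left h7 (by positivity)
  have h8c : (9 * (M : ℝ)) ^ 10 * (D * (2 * Y) ^ 12 * (289 * C₁ * Y ^ 12 * (M : ℝ) ^ (1 + ε) + 2754 * Y ^ 6 * (M : ℝ) ^ 4))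
      = P * Y ^ (12 * ε) * (289 * C₁ * T₁ + 2754 * T₂) := by
    have e3 : (9 * (M : ℝ)) ^ 10 * (D * (2 * Y) ^ 12 * (289 * C₁ * Y ^ 12 * (M : ℝ) ^ (1 + ε) + 2754 * Y ^ 6 * (M : ℝ) ^ 4))
        = (9 ^ 10 * 4 ^ 12 * C₂ ^ 12 * (128 : ℝ) ^ ε) * Y ^ (12 * ε) *
          (289 * C₁ * (Y ^ 24 * ((M : ℝ) ^ 10 * (M : ℝ) ^ (1 + ε))) + 2754 * (Y ^ 18 * ((M : ℝ) ^ 10 * (M : ℝ) ^ 4))) := by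
      rw [hDexp]; ring
    have e4 : (M : ℝ) ^ 10 * (M : ℝ) ^ 4 = (M : ℝ) ^ 14 := by ring
    rw [e3, hM10, e4, hT₁, hT₂, hP]
  have hin : 289 * C₁ * T₁ + 2754 * T₂ ≤ (289 * C₁ + 2754) * (T₁ + T₂) := by
    have e : (289 * C₁ + 2754) * (T₁ + T₂) = 289 * C₁ * T₁ + 2754 * T₂ + (289 * C₁ * T₂ + 2754 * T₁) := by ring
    rw [e]
    have : 0 ≤ 289 * C₁ * T₂ + 2754 * T₁ := by positivity
    linarith
  have h8 : Ssum ^ 12 ≤ K₀ * Y ^ (12 * ε) * (T₁ + T₂) := by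
    calc Ssum ^ 12 ≤ P * Y ^ (12 * ε) * (289 * C₁ * T₁ + 2754 * T₂) := by rw [← h8c]; exact h8a.trans h8b
      _ ≤ P * Y ^ (12 * ε) * ((289 * C₁ + 2754) * (T₁ + T₂)) := mul_le_mul_of_nonneg_left hin (by positivity)
      _ = K₀ * Y ^ (12 * ε) * (T₁ + T₂) := by rw [hK₀]; ring
  -- (9) twelfth roots
  have h9 : Ssum ≤ K₀ ^ (1 / 12 : ℝ) * Y ^ ε * (Y ^ 2 * (M : ℝ) ^ ((11 + ε) / 12) + Y ^ (3 / 2 : ℝ) * (M : ℝ) ^ (7 / 6 : ℝ)) := by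
    have e1 : Ssum = (Ssum ^ 12) ^ ((12 : ℕ) : ℝ)⁻¹ := (Real.pow_rpow_inv_natCast hSsum0 (by norm_num)).symm
    have e2 : ((12 : ℕ) : ℝ)⁻¹ = (1 / 12 : ℝ) := by norm_num
    rw [e1, e2]
    refine (Real.rpow_le_rpow (by positivity) h8 (by norm_num)).trans ?_
    rw [Real.mul_rpow (by positivity) (by positivity), Real.mul_rpow (by positivity) (by positivity),
      ← Real.rpow_mul hY0.le, show 12 * ε * (1 / 12 : ℝ) = ε by ring]
    obtain ⟨r1, r2⟩ := rpow_model_terms (ε := ε) hY0.le hM0.le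
    have hsub := Real.rpow_add_le_add_rpow hT₁0 hT₂0 (by norm_num : (0 : ℝ) ≤ 1 / 12) (by norm_num)
    rw [hT₁, hT₂, r1, r2] at hsub
    rw [hT₁, hT₂]
    exact mul_le_mul_of_nonneg_left hsub (by positivity)
  -- (10) absorb `M^{ε/12}` and `Y^ε` into `(Y M)^ε`
  have h10 : K₀ ^ (1 / 12 : ℝ) * Y ^ ε * (Y ^ 2 * (M : ℝ) ^ ((11 + ε) / 12) + Y ^ (3 / 2 : ℝ) * (M : ℝ) ^ (7 / 6 : ℝ))
      ≤ K₀ ^ (1 / 12 : ℝ) * (Y * M) ^ ε *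
        (Y ^ 2 * (M : ℝ) ^ (11 / 12 : ℝ) + Y ^ (3 / 2 : ℝ) * (M : ℝ) ^ (7 / 6 : ℝ)) := by
    have eM : (M : ℝ) ^ ((11 + ε) / 12) = (M : ℝ) ^ (11 / 12 : ℝ) * (M : ℝ) ^ (ε / 12) := by
      rw [← Real.rpow_add hM0]; congr 1; ring
    have hMe : (M : ℝ) ^ (ε / 12) ≤ (M : ℝ) ^ ε :=
      Real.rpow_le_rpow_of_exponent_le hMr (by linarith)
    have hMe1 : (1 : ℝ) ≤ (M : ℝ) ^ ε := Real.one_le_rpow hMr hε.le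
    rw [Real.mul_rpow hY0.le hM0.le, eM]
    have hK : (0 : ℝ) ≤ K₀ ^ (1 / 12 : ℝ) * Y ^ ε := by positivity
    have hA1 : (0 : ℝ) ≤ Y ^ 2 * (M : ℝ) ^ (11 / 12 : ℝ) := by positivity
    have hA2 : (0 : ℝ) ≤ Y ^ (3 / 2 : ℝ) * (M : ℝ) ^ (7 / 6 : ℝ) := by positivity
    have hin2 : Y ^ 2 * ((M : ℝ) ^ (11 / 12 : ℝ) * (M : ℝ) ^ (ε / 12)) + Y ^ (3 / 2 : ℝ) * (M : ℝ) ^ (7 / 6 : ℝ)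
        ≤ (M : ℝ) ^ ε * (Y ^ 2 * (M : ℝ) ^ (11 / 12 : ℝ) + Y ^ (3 / 2 : ℝ) * (M : ℝ) ^ (7 / 6 : ℝ)) := by
      have t1 : Y ^ 2 * ((M : ℝ) ^ (11 / 12 : ℝ) * (M : ℝ) ^ (ε / 12)) ≤ (M : ℝ) ^ ε * (Y ^ 2 * (M : ℝ) ^ (11 / 12 : ℝ)) := by
        calc Y ^ 2 * ((M : ℝ) ^ (11 / 12 : ℝ) * (M : ℝ) ^ (ε / 12))
            = (M : ℝ) ^ (ε / 12) * (Y ^ 2 * (M : ℝ) ^ (11 / 12 : ℝ)) := by ring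
          _ ≤ (M : ℝ) ^ ε * (Y ^ 2 * (M : ℝ) ^ (11 / 12 : ℝ)) := mul_le_mul_of_nonneg_right hMe hA1
      have t2 : Y ^ (3 / 2 : ℝ) * (M : ℝ) ^ (7 / 6 : ℝ) ≤ (M : ℝ) ^ ε * (Y ^ (3 / 2 : ℝ) * (M : ℝ) ^ (7 / 6 : ℝ)) :=
        le_mul_of_one_le_left hA2 hMe1
      linarith
    calc K₀ ^ (1 / 12 : ℝ) * Y ^ ε *
          (Y ^ 2 * ((M : ℝ) ^ (11 / 12 : ℝ) * (M : ℝ) ^ (ε / 12)) + Y ^ (3 / 2 : ℝ) * (M : ℝ) ^ (7 / 6 : ℝ))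
        ≤ K₀ ^ (1 / 12 : ℝ) * Y ^ ε *
          ((M : ℝ) ^ ε * (Y ^ 2 * (M : ℝ) ^ (11 / 12 : ℝ) + Y ^ (3 / 2 : ℝ) * (M : ℝ) ^ (7 / 6 : ℝ))) :=
          mul_le_mul_of_nonneg_left hin2 hK
      _ = K₀ ^ (1 / 12 : ℝ) * (Y ^ ε * (M : ℝ) ^ ε) *
          (Y ^ 2 * (M : ℝ) ^ (11 / 12 : ℝ) + Y ^ (3 / 2 : ℝ) * (M : ℝ) ^ (7 / 6 : ℝ)) := by ring
  rw [hY] at h9 h10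
  exact h1.trans (h9.trans h10)

/-! ### Step C: Proposition 21.3 for `Q*(M, N)` -/

/-- The primary primitive `w` with `|w|² ≤ M` (the range of `Σ*` in (21.1), and of both variables in `Q*`).
[cite: FriedlanderIwaniecAnnals1998, (21.1)-(21.2)] -/
def ppDisc (M : ℕ) : Finset GaussianInt :=
  (gaussBox M).filter fun w => IsPrimary w ∧ IsPrimitive w ∧ w.norm ≤ M

/-- Membership in `ppDisc`. [folklore] -/
theorem mem_ppDisc {M : ℕ} {w : GaussianInt} : w ∈ ppDisc M ↔ IsPrimary w ∧ IsPrimitive w ∧ w.norm ≤ M := by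
  rw [ppDisc, mem_filter]
  exact ⟨fun h => h.2, fun h => ⟨mem_gaussBox_of_norm_le h.2.2, h⟩⟩

/-- **`Q*(M, N)`**: the form (21.1) with both `w` and `z` restricted to primary primitive numbers,
`Q* = Σ_{w pp, |w|² ≤ M} Σ_{z pp, |z|² ≤ N} α_w β_z (z/w)`. [cite: FriedlanderIwaniecAnnals1998, §21 before Proposition 21.3] -/
def dirichletBilinStar (α β : GaussianInt → ℂ) (M N : ℕ) : ℂ := dirichletBilin α β (ppDisc M) (ppDisc N)

/-- **Symmetry of `Q*` under the reciprocity law (19.12)**: "Interchanging `w` with `z` we switch `M` with `N`".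
[cite: FriedlanderIwaniecAnnals1998, §21 before Proposition 21.3] -/
theorem dirichletBilinStar_symm (α β : GaussianInt → ℂ) (M N : ℕ) :
    dirichletBilinStar α β M N = dirichletBilinStar β α N M := by
  rw [dirichletBilinStar, dirichletBilinStar, dirichletBilin_def, dirichletBilin_def, sum_comm]
  refine sum_congr rfl fun z hz => sum_congr rfl fun w hw => ?_
  obtain ⟨hzp, hzq, -⟩ := mem_ppDisc.mp hz
  obtain ⟨hwp, hwq, -⟩ := mem_ppDisc.mp hw
  rw [dirichletSym_comm hwp hwq hzp hzq]; ring

/-- A Gaussian integer of norm at most `N` lies in the box `⌊√N⌋`. [folklore] -/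
theorem mem_gaussBox_sqrt_of_norm_le {N : ℕ} {z : GaussianInt} (h : z.norm ≤ N) : z ∈ gaussBox (Nat.sqrt N) := by
  have e : z.norm = z.re ^ 2 + z.im ^ 2 := by rw [Zsqrtd.norm_def]; ring
  rw [e] at h
  have hre : z.re.natAbs ≤ Nat.sqrt N := by
    rw [Nat.le_sqrt']
    have : (z.re.natAbs : ℤ) ^ 2 ≤ N := by rw [Int.natAbs_sq]; nlinarith [sq_nonneg z.im]
    exact_mod_cast this
  have him : z.im.natAbs ≤ Nat.sqrt N := by
    rw [Nat.le_sqrt']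
    have : (z.im.natAbs : ℤ) ^ 2 ≤ N := by rw [Int.natAbs_sq]; nlinarith [sq_nonneg z.re]
    exact_mod_cast this
  rw [mem_gaussBox, Int.abs_eq_natAbs, Int.abs_eq_natAbs]
  exact ⟨by exact_mod_cast hre, by exact_mod_cast him⟩

/-- `ppDisc N` lies in the box `⌊√N⌋`. [folklore] -/
theorem ppDisc_subset_gaussBox_sqrt (N : ℕ) : ppDisc N ⊆ gaussBox (Nat.sqrt N) := fun _ hz =>
  mem_gaussBox_sqrt_of_norm_le (mem_ppDisc.mp hz).2.2

/-- `#ppDisc N ≤ 9N` for `N ≥ 1`. [folklore] -/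
theorem card_ppDisc_le {N : ℕ} (hN : 1 ≤ N) : (#(ppDisc N) : ℝ) ≤ 9 * N := by
  have h := card_le_of_norm_le (ppDisc N) fun w hw => by
    have := (mem_ppDisc.mp hw).2.2
    have h0 := GaussianInt.abs_natCast_norm w
    have : (w.norm.natAbs : ℤ) ≤ N := by rw [h0]; exact this
    exact_mod_cast this
  calc (#(ppDisc N) : ℝ) ≤ (((2 * Nat.sqrt N + 1) ^ 2 : ℕ) : ℝ) := by exact_mod_cast h
    _ ≤ 9 * N := by push_cast; exact sq_two_sqrt_add_one_le hN

/-- `(⌊√N⌋ + 1)² ≤ 4N` for `N ≥ 1`. [folklore] -/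
theorem sqrt_add_one_sq_le {N : ℕ} (hN : 1 ≤ N) : ((Nat.sqrt N : ℝ) + 1) ^ 2 ≤ 4 * N := by
  have h1 : Nat.sqrt N ^ 2 ≤ N := Nat.sqrt_le' N
  have h2 : Nat.sqrt N ≤ N := Nat.sqrt_le_self N
  have : (Nat.sqrt N + 1) ^ 2 ≤ 4 * N := by nlinarith
  exact_mod_cast this

/-- The one-sided bound: `‖Q*(M, N)‖ ≤ 9N + 4 C 2^ε (MN)^ε (N M^{11/12} + N^{3/4} M^{7/6})`.
[cite: FriedlanderIwaniecAnnals1998, (21.9) for Q*] -/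
theorem norm_dirichletBilinStar_le_aux {ε : ℝ} (hε : 0 < ε) :
    ∃ C : ℝ, 0 < C ∧ ∀ (M N : ℕ), 1 ≤ M → 1 ≤ N → ∀ (α β : GaussianInt → ℂ),
      (∀ w, ‖α w‖ ≤ 1) → (∀ z, ‖β z‖ ≤ 1) →
        ‖dirichletBilinStar α β M N‖ ≤
          9 * N + C * ((M : ℝ) * N) ^ ε * (N * (M : ℝ) ^ (11 / 12 : ℝ) + (N : ℝ) ^ (3 / 4 : ℝ) * (M : ℝ) ^ (7 / 6 : ℝ)) := by
  obtain ⟨C, hC, hB⟩ := norm_dirichletBilin_box_le_rpow hε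
  refine ⟨4 * C * (2 : ℝ) ^ ε, by positivity, fun M N hM hN α β hα hβ => ?_⟩
  classical
  have hMr : (1 : ℝ) ≤ M := by exact_mod_cast hM
  have hNr : (1 : ℝ) ≤ N := by exact_mod_cast hN
  set X := Nat.sqrt N with hX
  -- extend `β` by zero off `ppDisc N` and pass to the box
  obtain ⟨β', hβ'⟩ : ∃ β' : GaussianInt → ℂ, β' = fun z => if z ∈ ppDisc N then β z else 0 := ⟨_, rfl⟩
  have hβ'1 : ∀ z, ‖β' z‖ ≤ 1 := fun z => by
    rw [hβ']; dsimp only; split_ifs <;> simp [hβ z]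
  have e1 : dirichletBilinStar α β M N = dirichletBilin α β' (ppDisc M) (gaussBox X) := by
    rw [dirichletBilinStar, dirichletBilin_def, dirichletBilin_def]
    refine sum_congr rfl fun w _ => ?_
    rw [hβ']
    simp_rw [show ∀ z, α w * (if z ∈ ppDisc N then β z else 0) * (dirichletSym z w : ℂ) =
      if z ∈ ppDisc N then α w * β z * (dirichletSym z w : ℂ) else 0 from fun z => by split_ifs <;> simp]
    rw [← sum_filter, Finset.filter_mem_eq_inter, (inter_eq_right.mpr (ppDisc_subset_gaussBox_sqrt N))]
  -- split off `w` of norm `1`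
  set W' := (ppDisc M).filter fun w => 2 ≤ w.norm.natAbs with hW'
  set W₁ := (ppDisc M).filter fun w => ¬ 2 ≤ w.norm.natAbs with hW₁
  have e2 : dirichletBilin α β' (ppDisc M) (gaussBox X) =
      dirichletBilin α β' W₁ (gaussBox X) + dirichletBilin α β' W' (gaussBox X) := by
    simp only [dirichletBilin_def, hW', hW₁]
    rw [add_comm]
    exact (sum_filter_add_sum_filter_not (ppDisc M) (fun w => 2 ≤ w.norm.natAbs) _).symm
  -- the norm-one part: `W₁ ⊆ {1}` and each inner sum is at most `#ppDisc N ≤ 9N`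
  have hW₁card : #W₁ ≤ 1 := by
    rw [← card_singleton (1 : GaussianInt), ← primaryNormEq_one]
    refine card_le_card fun w hw => ?_
    rw [hW₁, mem_filter] at hw
    obtain ⟨hw, h2⟩ := hw
    obtain ⟨hp, hq, -⟩ := mem_ppDisc.mp hw
    have h0 := natAbs_norm_ne_zero_of_isPrimary hp
    have h1 : w.norm.natAbs = 1 := by omega
    refine mem_primaryNormEq.mpr ⟨?_, hp⟩
    rw [← GaussianInt.abs_natCast_norm, h1]
  have hsmall : ‖dirichletBilin α β' W₁ (gaussBox X)‖ ≤ 9 * N := by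
    rw [dirichletBilin_def]
    have hinner : ∀ w ∈ W₁, ‖∑ z ∈ gaussBox X, α w * β' z * (dirichletSym z w : ℂ)‖ ≤ 9 * N := by
      intro w _
      refine (norm_sum_le _ _).trans ?_
      have hterm : ∀ z ∈ gaussBox X, ‖α w * β' z * (dirichletSym z w : ℂ)‖ ≤ if z ∈ ppDisc N then 1 else 0 := by
        intro z _
        rw [hβ']; dsimp only
        split_ifs with hz
        · rw [norm_mul, norm_mul]
          calc ‖α w‖ * ‖β z‖ * ‖(dirichletSym z w : ℂ)‖ ≤ 1 * 1 * 1 := by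
                gcongr
                · exact hα w
                · exact hβ z
                · exact norm_cast_dirichletSym_le z w
            _ = 1 := by ring
        · simp
      refine (sum_le_sum hterm).trans ?_
      rw [← sum_filter, Finset.filter_mem_eq_inter, inter_eq_right.mpr (ppDisc_subset_gaussBox_sqrt N),
        sum_const, nsmul_eq_mul, mul_one]
      exact card_ppDisc_le hN
    refine (norm_sum_le _ _).trans ((sum_le_card_nsmul _ _ _ hinner).trans ?_)
    rw [nsmul_eq_mul]
    have : (#W₁ : ℝ) ≤ 1 := by exact_mod_cast hW₁card
    have h9 : (0 : ℝ) ≤ 9 * N := by positivity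
    nlinarith
  -- the main part by Step B
  have hW'hyp : ∀ w ∈ W', (IsPrimary w ∧ IsPrimitive w) ∧ 2 ≤ w.norm.natAbs ∧ w.norm.natAbs ≤ M := by
    intro w hw
    rw [hW', mem_filter] at hw
    obtain ⟨hw, h2⟩ := hw
    obtain ⟨hp, hq, hn⟩ := mem_ppDisc.mp hw
    refine ⟨⟨hp, hq⟩, h2, ?_⟩
    have : (w.norm.natAbs : ℤ) ≤ M := by rw [GaussianInt.abs_natCast_norm]; exact hn
    exact_mod_cast this
  have hmain := hB M X W' hW'hyp α β' hα hβ'1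
  -- numerics: `X + 1 ≤ 2√N`
  have hX2 : ((X : ℝ) + 1) ^ 2 ≤ 4 * N := sqrt_add_one_sq_le hN
  have hX1 : (X : ℝ) + 1 ≤ 2 * N := by nlinarith
  have hX0 : (0 : ℝ) < (X : ℝ) + 1 := by positivity
  have hMN : (1 : ℝ) ≤ (M : ℝ) * N := by nlinarith
  have hε1 : (((X : ℝ) + 1) * M) ^ ε ≤ (2 : ℝ) ^ ε * ((M : ℝ) * N) ^ ε := by
    rw [← Real.mul_rpow (by norm_num) (by positivity)]
    exact Real.rpow_le_rpow (by positivity) (by nlinarith) hε.le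
  have h32 : ((X : ℝ) + 1) ^ (3 / 2 : ℝ) ≤ 4 * (N : ℝ) ^ (3 / 4 : ℝ) := by
    have e : ((X : ℝ) + 1) ^ (3 / 2 : ℝ) = (((X : ℝ) + 1) ^ 2) ^ (3 / 4 : ℝ) := by
      rw [← Real.rpow_natCast ((X : ℝ) + 1) 2, ← Real.rpow_mul hX0.le]; norm_num
    rw [e]
    calc (((X : ℝ) + 1) ^ 2) ^ (3 / 4 : ℝ) ≤ (4 * (N : ℝ)) ^ (3 / 4 : ℝ) :=
          Real.rpow_le_rpow (by positivity) hX2 (by norm_num)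
      _ = (4 : ℝ) ^ (3 / 4 : ℝ) * (N : ℝ) ^ (3 / 4 : ℝ) := Real.mul_rpow (by norm_num) (by positivity)
      _ ≤ 4 * (N : ℝ) ^ (3 / 4 : ℝ) := by
          gcongr
          calc (4 : ℝ) ^ (3 / 4 : ℝ) ≤ (4 : ℝ) ^ (1 : ℝ) := Real.rpow_le_rpow_of_exponent_le (by norm_num) (by norm_num)
            _ = 4 := Real.rpow_one 4
  have hbig : ‖dirichletBilin α β' W' (gaussBox X)‖ ≤
      4 * C * (2 : ℝ) ^ ε * ((M : ℝ) * N) ^ ε * (N * (M : ℝ) ^ (11 / 12 : ℝ) + (N : ℝ) ^ (3 / 4 : ℝ) * (M : ℝ) ^ (7 / 6 : ℝ)) := by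
    refine hmain.trans ?_
    have hA : ((X : ℝ) + 1) ^ 2 * (M : ℝ) ^ (11 / 12 : ℝ) + ((X : ℝ) + 1) ^ (3 / 2 : ℝ) * (M : ℝ) ^ (7 / 6 : ℝ) ≤
        4 * (N * (M : ℝ) ^ (11 / 12 : ℝ) + (N : ℝ) ^ (3 / 4 : ℝ) * (M : ℝ) ^ (7 / 6 : ℝ)) := by
      have t1 : ((X : ℝ) + 1) ^ 2 * (M : ℝ) ^ (11 / 12 : ℝ) ≤ 4 * N * (M : ℝ) ^ (11 / 12 : ℝ) :=
        mul_le_mul_of_nonneg_right hX2 (by positivity)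
      have t2 : ((X : ℝ) + 1) ^ (3 / 2 : ℝ) * (M : ℝ) ^ (7 / 6 : ℝ) ≤ 4 * (N : ℝ) ^ (3 / 4 : ℝ) * (M : ℝ) ^ (7 / 6 : ℝ) :=
        mul_le_mul_of_nonneg_right h32 (by positivity)
      linarith
    have h0 : (0 : ℝ) ≤ N * (M : ℝ) ^ (11 / 12 : ℝ) + (N : ℝ) ^ (3 / 4 : ℝ) * (M : ℝ) ^ (7 / 6 : ℝ) := by positivity
    calc C * (((X : ℝ) + 1) * M) ^ ε *
          (((X : ℝ) + 1) ^ 2 * (M : ℝ) ^ (11 / 12 : ℝ) + ((X : ℝ) + 1) ^ (3 / 2 : ℝ) * (M : ℝ) ^ (7 / 6 : ℝ))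
        ≤ C * ((2 : ℝ) ^ ε * ((M : ℝ) * N) ^ ε) *
          (4 * (N * (M : ℝ) ^ (11 / 12 : ℝ) + (N : ℝ) ^ (3 / 4 : ℝ) * (M : ℝ) ^ (7 / 6 : ℝ))) := by
          gcongr
      _ = _ := by ring
  -- assemble
  rw [e1, e2]
  refine (norm_add_le _ _).trans ?_
  linarith

/-- `M N^{11/12} ≤ (M+N)^{1/12} (MN)^{11/12}` and, for `N ≤ M`, `M^{3/4} N^{7/6} ≤ M N^{11/12}`. [folklore] -/
theorem model_terms_le {M N : ℝ} (hM : 1 ≤ M) (hN : 1 ≤ N) (hNM : N ≤ M) :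
    M * N ^ (11 / 12 : ℝ) ≤ (M + N) ^ (1 / 12 : ℝ) * (M * N) ^ (11 / 12 : ℝ) ∧
      M ^ (3 / 4 : ℝ) * N ^ (7 / 6 : ℝ) ≤ M * N ^ (11 / 12 : ℝ) ∧
      M ≤ (M + N) ^ (1 / 12 : ℝ) * (M * N) ^ (11 / 12 : ℝ) := by
  have hM0 : 0 < M := by linarith
  have hN0 : 0 < N := by linarith
  have eM : M = M ^ (1 / 12 : ℝ) * M ^ (11 / 12 : ℝ) := by
    rw [← Real.rpow_add hM0]; norm_num
  have hMN : (M * N) ^ (11 / 12 : ℝ) = M ^ (11 / 12 : ℝ) * N ^ (11 / 12 : ℝ) := Real.mul_rpow hM0.le hN0.le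
  have h12 : M ^ (1 / 12 : ℝ) ≤ (M + N) ^ (1 / 12 : ℝ) := Real.rpow_le_rpow hM0.le (by linarith) (by norm_num)
  refine ⟨?_, ?_, ?_⟩
  · rw [hMN]
    calc M * N ^ (11 / 12 : ℝ) = M ^ (1 / 12 : ℝ) * (M ^ (11 / 12 : ℝ) * N ^ (11 / 12 : ℝ)) := by
          conv_lhs => rw [eM]
          ring
      _ ≤ (M + N) ^ (1 / 12 : ℝ) * (M ^ (11 / 12 : ℝ) * N ^ (11 / 12 : ℝ)) :=
          mul_le_mul_of_nonneg_right h12 (by positivity)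
  · have eN : N ^ (7 / 6 : ℝ) = N ^ (1 / 4 : ℝ) * N ^ (11 / 12 : ℝ) := by
      rw [← Real.rpow_add hN0]; norm_num
    have eM' : M = M ^ (3 / 4 : ℝ) * M ^ (1 / 4 : ℝ) := by
      rw [← Real.rpow_add hM0]; norm_num
    have h14 : N ^ (1 / 4 : ℝ) ≤ M ^ (1 / 4 : ℝ) := Real.rpow_le_rpow hN0.le hNM (by norm_num)
    calc M ^ (3 / 4 : ℝ) * N ^ (7 / 6 : ℝ) = M ^ (3 / 4 : ℝ) * N ^ (1 / 4 : ℝ) * N ^ (11 / 12 : ℝ) := by rw [eN]; ring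
      _ ≤ M ^ (3 / 4 : ℝ) * M ^ (1 / 4 : ℝ) * N ^ (11 / 12 : ℝ) := by gcongr
      _ = M * N ^ (11 / 12 : ℝ) := by rw [← eM']
  · have hN1 : (1 : ℝ) ≤ N ^ (11 / 12 : ℝ) := Real.one_le_rpow hN (by norm_num)
    rw [hMN]
    calc M = M ^ (1 / 12 : ℝ) * M ^ (11 / 12 : ℝ) * 1 := by rw [mul_one, ← eM]
      _ ≤ (M + N) ^ (1 / 12 : ℝ) * M ^ (11 / 12 : ℝ) * N ^ (11 / 12 : ℝ) := by gcongr
      _ = _ := by ring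

/-- **Friedlander–Iwaniec, Proposition 21.3 for `Q*(M, N)`** (as displayed in the source before Proposition
21.3): for every `ε > 0` there is `C` such that for all `M, N ≥ 1` and all coefficients `|α_w|, |β_z| ≤ 1`,
`|Σ_{w pp, |w|² ≤ M} Σ_{z pp, |z|² ≤ N} α_w β_z (z/w)| ≤ C (M + N)^{1/12} (MN)^{11/12 + ε}`
(`pp` = primary and primitive, `(z/w)` the Dirichlet symbol (19.10)).
[cite: FriedlanderIwaniecAnnals1998, Proposition 21.3 (for Q*, (21.9)-(21.10))] -/
theorem norm_dirichletBilinStar_le {ε : ℝ} (hε : 0 < ε) :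
    ∃ C : ℝ, 0 < C ∧ ∀ (M N : ℕ), 1 ≤ M → 1 ≤ N → ∀ (α β : GaussianInt → ℂ),
      (∀ w, ‖α w‖ ≤ 1) → (∀ z, ‖β z‖ ≤ 1) →
        ‖dirichletBilinStar α β M N‖ ≤
          C * ((M : ℝ) + N) ^ (1 / 12 : ℝ) * ((M : ℝ) * N) ^ (11 / 12 + ε) := by
  obtain ⟨C, hC, haux⟩ := norm_dirichletBilinStar_le_aux hε
  refine ⟨9 + 2 * C, by positivity, fun M N hM hN α β hα hβ => ?_⟩
  have hMr : (1 : ℝ) ≤ M := by exact_mod_cast hM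
  have hNr : (1 : ℝ) ≤ N := by exact_mod_cast hN
  have hM0 : (0 : ℝ) < M := by linarith
  have hN0 : (0 : ℝ) < N := by linarith
  have esplit : ((M : ℝ) * N) ^ (11 / 12 + ε) = ((M : ℝ) * N) ^ (11 / 12 : ℝ) * ((M : ℝ) * N) ^ ε :=
    Real.rpow_add (by positivity) _ _
  have hε1 : (1 : ℝ) ≤ ((M : ℝ) * N) ^ ε := Real.one_le_rpow (by nlinarith) hε.le
  -- the generic final step, given the one-sided bound in the favourable orientation
  have key : ∀ {A B : ℝ}, 1 ≤ A → 1 ≤ B → B ≤ A → ∀ {Q : ℝ},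
      Q ≤ 9 * A + C * (B * A) ^ ε * (A * B ^ (11 / 12 : ℝ) + A ^ (3 / 4 : ℝ) * B ^ (7 / 6 : ℝ)) →
      Q ≤ (9 + 2 * C) * (A + B) ^ (1 / 12 : ℝ) * ((A * B) ^ (11 / 12 : ℝ) * (A * B) ^ ε) := by
    intro A B hA hB hBA Q hQ
    obtain ⟨m1, m2, m3⟩ := model_terms_le hA hB hBA
    have hR0 : 0 ≤ (A + B) ^ (1 / 12 : ℝ) * (A * B) ^ (11 / 12 : ℝ) := by positivity
    have hε1' : (1 : ℝ) ≤ (A * B) ^ ε := Real.one_le_rpow (by nlinarith) (le_of_lt hε)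
    have hBA' : (B * A) ^ ε = (A * B) ^ ε := by rw [mul_comm]
    rw [hBA'] at hQ
    have hsum : A * B ^ (11 / 12 : ℝ) + A ^ (3 / 4 : ℝ) * B ^ (7 / 6 : ℝ) ≤
        2 * ((A + B) ^ (1 / 12 : ℝ) * (A * B) ^ (11 / 12 : ℝ)) := by linarith
    have h9 : 9 * A ≤ 9 * ((A + B) ^ (1 / 12 : ℝ) * (A * B) ^ (11 / 12 : ℝ)) * (A * B) ^ ε := by
      calc 9 * A ≤ 9 * ((A + B) ^ (1 / 12 : ℝ) * (A * B) ^ (11 / 12 : ℝ)) := by linarith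
        _ ≤ 9 * ((A + B) ^ (1 / 12 : ℝ) * (A * B) ^ (11 / 12 : ℝ)) * (A * B) ^ ε :=
            le_mul_of_one_le_right (by positivity) hε1'
    have hCpart : C * (A * B) ^ ε * (A * B ^ (11 / 12 : ℝ) + A ^ (3 / 4 : ℝ) * B ^ (7 / 6 : ℝ)) ≤
        C * (A * B) ^ ε * (2 * ((A + B) ^ (1 / 12 : ℝ) * (A * B) ^ (11 / 12 : ℝ))) :=
      mul_le_mul_of_nonneg_left hsum (by positivity)
    calc Q ≤ _ := hQ
      _ ≤ 9 * ((A + B) ^ (1 / 12 : ℝ) * (A * B) ^ (11 / 12 : ℝ)) * (A * B) ^ ε +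
            C * (A * B) ^ ε * (2 * ((A + B) ^ (1 / 12 : ℝ) * (A * B) ^ (11 / 12 : ℝ))) := add_le_add h9 hCpart
      _ = (9 + 2 * C) * (A + B) ^ (1 / 12 : ℝ) * ((A * B) ^ (11 / 12 : ℝ) * (A * B) ^ ε) := by ring
  rw [esplit]
  rcases le_total (N : ℝ) M with hNM | hMN
  · -- `N ≤ M`: use the bound for `Q*(β, α; N, M)`
    have h := haux N M hN hM β α hβ hα
    rw [← dirichletBilinStar_symm] at h
    exact key hMr hNr hNM h
  · have h := haux M N hM hN α β hα hβ
    have := key hNr hMr hMN (Q := ‖dirichletBilinStar α β M N‖) (by rw [mul_comm (M : ℝ) N] at h ⊢; convert h using 2)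
    calc ‖dirichletBilinStar α β M N‖ ≤ (9 + 2 * C) * ((N : ℝ) + M) ^ (1 / 12 : ℝ) * (((N : ℝ) * M) ^ (11 / 12 : ℝ) * ((N : ℝ) * M) ^ ε) := this
      _ = (9 + 2 * C) * ((M : ℝ) + N) ^ (1 / 12 : ℝ) * (((M : ℝ) * N) ^ (11 / 12 : ℝ) * ((M : ℝ) * N) ^ ε) := by
          rw [add_comm (N : ℝ) M, mul_comm (N : ℝ) M]

end Literature.NumberTheory.Sieve.FriedlanderIwaniecPrimes

end
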